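import Summits.QuantumFields.BalabanUV.Beta.D1BFx.RoadEndBFxRows
import Summits.QuantumFields.BalabanUV.Beta.D1BFx.LocalTadpoleRows
import Summits.QuantumFields.BalabanUV.Beta.D1BFx.GluonBubbleTails
import Summits.QuantumFields.BalabanUV.Beta.D1BFx.CrossERecutTails
import Summits.QuantumFields.BalabanUV.Beta.D1BFx.LocalTadpoleRowsDecay

/-!
# `BalabanUV.Beta.D1BFx.LocalGroupRow` — road «BF-x» for binder row D1, slot (K), END row `hGrp`, «L-WIRE»: THE LOCAL GROUP HYPOTHESIS `hLoc` OF
# `RoadEndBFxRows.hGrp_of_rows` (one n-uniform bound per word of `localFibre`, 22 indices) WIRED FROM THE TREE's PER-WORD THEOREMS — the cross word L-X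
# (`CrossERecutTails.hLoc_crossE'_of_prop12`, leaf-03-g12), the eight gluon bubble words L-BUB (`GluonBubbleTails.hLoc_bub_of_prop12`, leaf-03-g12), the three
# slot-J tadpoles (`LocalTadpoleRows.hLoc_tad_J_of_cJ4_zero`, `cJ4 = 0`), the three slot-E tadpoles (`LocalTadpoleRows.hLoc_tad_of_local_entry_scaling`, leaf-04-g8, from
# the END's slot-E sockets DISPLAYED here: bi-localisation, finite support, the scaling letter `|ωgl·cE₂|·C_E ≤ k·n⁸`), the two zero words (re-cut `0000` words = 0) —
# MODULO SIX DISPLAYED WORD BOUNDS: the three slot-R tadpoles «L-TAD-R» (`WR` awaits (A2)) and the three local ghost bubbles «L-GBUB» (block-mass wiring, claimable)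

HONEST DEPENDENCY (cell records, verbatim): «continuum YM on T⁴ ⇐ BetaPertH ∧ nine spine estimates (0/9 proved); BetaPertH ⇐ (D1) ∧ (D4) ∧
CAP+tail; G-an2-4 gates asym, D1 and NE2/3/4.»  HONEST FRAMING (cell contract, verbatim): «discharging `BetaPertH` makes Bałaban's UV stability
UNCONDITIONAL — a real constructive-QFT result; it is NOT the continuum limit and NOT the Clay problem.»  THIS MODULE DISCHARGES NOTHING of the
wall: [folklore] finite bookkeeping BY NAME over the index type `RestIdx` (`SplitInstance`), the fibre membership lemmas (`RoadEndBFxRows.mem_localFibre`,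
`LamGroupPointwise.mem_lamFibre_tad ∕ _bub ∕ not_mem_lamFibre_inr_inr`, `NeedleGroupPointwise.mem_needleFibre'_tad ∕ _bub ∕ _gbub ∕ _gtad ∕ not_mem_needleFibre'_last`),
the re-cut word list (`SplitRecut.restK'_bub ∕ restK'_gbub`: the `0000` words are `0`; `Assembly.fullSum_zero'`) and the four per-word theorems named above.  No `def`,
no `def … : Prop`, nothing cited, 0 sorry; the printed statements (`h12`, `h126`), the pins (`hlam`, `cJ4 = 0`), the slot-E sockets and the six open words are
HYPOTHESES, displayed.  Root-level binders hW ∕ hR-sockets ∕ hSX-socket ∕ D1Tel ∕ D1Rep — 0 discharged; (K) NOT closed; NOT D1, NOT `BetaPertH`, NOT continuum, NOT Clay.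

ABSOLUTE RULE (cell charter, verbatim): «No internally-minted statement may enter as a cited fact. Every hypothesis is either kernel-proved in
this package or a verbatim quotation of a PUBLISHED theorem with page reference. The manuscript(s) under audit are NOT citable for their own
disputed steps — they are the thing under adjudication; programme-internal (2001/route/tribunal) claims are never citable.»

WHY (owner memo `HOME/b2b-balaban-beta-d1-p2/K-LOCAL-ROWS.md` v0–v0.3: the 21 substantive LOCAL words = L-TAD-E 3 + L-TAD-J 3 + L-TAD-R 3 + L-BUB 8 + L-GBUB 3 + L-X 1;
`localFibre` also contains the two re-cut `0000` words, identically `0`).  The LOCAL group is the complement of the Λ-fibre, the needle fibre of record and the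
corner: `inl (s,r)` with `s ∈ {0,1,3}`, `inr (inl (0,0,r,r′))`, `inr (inr (inr (inl (0,0,r,r′))))`, `inr (inr (inr (inr 1)))`.
* §1 [folklore] `hLoc_bub_zero`, `hLoc_gbub_zero` (the two re-cut `0000` words), `exists_hLoc_bub_all` (L-BUB incl. the zero word, one constant per `(r,r′)`).
* §3 (v1.1) [folklore] **`hLoc_of_prop12'`** — the same with the three slot-R words supplied by leaf-04-g10's `LocalTadpoleRowsDecay.hLoc_tad_of_decay_scaling` from slot R's SOCKETS (envelope + units line, displayed); L-GBUB stays a displayed word bound.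
* §2 [folklore] `fin3_eq_zero`, `fin2_eq_zero`, **`hLoc_of_prop12`** — `∃ CL : RestIdx → ℝ, ∀ n ≥ 2, ∀ τ ∈ localFibre, |Σ_{b ∈ image resSite} n⁻⁴·fullSum (w ↦ restK′ … τ w)| ≤ CL τ` (= `hLoc` of
  `RoadEndBFxRows.hGrp_of_rows` VERBATIM), modulo the displayed six word bounds and the slot-E sockets.
NOT HERE (honest): «L-TAD-R» (3), «L-GBUB» (3); the Λ row; the needle row (`NeedleGroupRow`); `hGrp_of_rows` itself.
Unit `b2b-balaban-beta-d1-p2` (gen 11), road «BF-x» OWNER; `LEAVES-BFx.md` row «L-WIRE».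
-/

noncomputable section

open Finset Filter Topology
open scoped BigOperators
open Literature.MathematicalPhysics.QuantumFieldTheory.Balaban1983to89
open Literature.MathematicalPhysics.QuantumFieldTheory.Balaban1983to89.Beta
open ExpKernelCalculus (Site MKer BiLoc Zl)
open DyadicShell (Pt toReal supNorm)
open WindowIdentification (fullSum)
open DressedMomentNormalisation (resSite)
open VectorTailsLoc (fam kfam)
open LongitudinalWindow (ellD0)
open WoodburyCovariant (woodburyDc)
open Summit.QuantumFields.BalabanUV.Beta.D1BFx.FrozenLegTails (nOf MOf hn1)
open Summit.QuantumFields.BalabanUV.Beta.D1BFx.ReducedKernel (TableR)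
open Summit.QuantumFields.BalabanUV.Beta.D1BFx.FineHessianSectors (slotWt slotTab)
open Summit.QuantumFields.BalabanUV.Beta.D1BFx.FrozenLegProfile (gfrz)
open Summit.QuantumFields.BalabanUV.Beta.D1BFx.SplitInstance (RestIdx)
open Summit.QuantumFields.BalabanUV.Beta.D1BFx.SplitRecut (restK' restK'_bub restK'_gbub)
open Summit.QuantumFields.BalabanUV.Beta.D1BFx.RoadEndBFxRecut (cornerIdx)
open Summit.QuantumFields.BalabanUV.Beta.D1BFx.Assembly (fullSum_zero')
open Summit.QuantumFields.BalabanUV.Beta.D1BFx.PointColumnSplit (cG0)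
open Summit.QuantumFields.BalabanUV.Beta.D1BFx.LamGroupPointwise (lamFibre mem_lamFibre_tad mem_lamFibre_bub not_mem_lamFibre_inr_inr)
open Summit.QuantumFields.BalabanUV.Beta.D1BFx.NeedleGroupPointwise (needleFibre' mem_needleFibre'_tad mem_needleFibre'_bub mem_needleFibre'_gbub
  mem_needleFibre'_gtad not_mem_needleFibre'_last)
open Summit.QuantumFields.BalabanUV.Beta.D1BFx.RoadEndBFxRows (localFibre mem_localFibre)
open Summit.QuantumFields.BalabanUV.Beta.D1BFx.LocalTadpoleRows (hLoc_tad_of_local_entry_scaling hLoc_tad_J_of_cJ4_zero)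
open Summit.QuantumFields.BalabanUV.Beta.D1BFx.GluonBubbleTails (hLoc_bub_of_prop12)
open Summit.QuantumFields.BalabanUV.Beta.D1BFx.CrossERecutTails (hLoc_crossE'_of_prop12)

namespace Summit.QuantumFields.BalabanUV.Beta.D1BFx.LocalGroupRow

variable {a N : ℝ} {μ ν : Fin 4} {cE cΛ cR cK cQ cE₂ cJ4 cΛ₂ cR₂ cQ₂ x₀ ωgl ωgh : ℕ → ℝ} {WE WJ WΛ WR WQ : ℕ → TableR}

/-! ## §1 The two re-cut zero words; the gluon bubble family with one constant per leg pair -/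

/-- [folklore] the re-cut gluon bubble `0000` word is `0` (its row is bounded by `0`). -/
theorem hLoc_bub_zero : ∀ n : ℕ, 2 ≤ n → ∀ [NeZero n],
    |∑ b ∈ (univ : Finset (Fin 4 → Fin n)).image resSite, ((n : ℝ) ^ 4)⁻¹ *
      fullSum (fun w : Pt => restK' n a (gfrz n a b) (cE n) (cΛ n) (cR n) (cK n) (cQ n) (cE₂ n) (cJ4 n) (cΛ₂ n) (cR₂ n) (cQ₂ n) (x₀ n)
        (WE n) (WJ n) (WΛ n) (WR n) (WQ n) (ωgl n) (ωgh n) ((n : ℝ) ^ 8) N μ ν b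
          (Sum.inr (Sum.inl (((0 : Fin 3), (0 : Fin 3), (0 : Fin 3), (0 : Fin 3))))) w)| ≤ 0 := by
  intro n _ _
  have h0 : ∀ b : Pt, (fun w : Pt => restK' n a (gfrz n a b) (cE n) (cΛ n) (cR n) (cK n) (cQ n) (cE₂ n) (cJ4 n) (cΛ₂ n) (cR₂ n) (cQ₂ n) (x₀ n)
      (WE n) (WJ n) (WΛ n) (WR n) (WQ n) (ωgl n) (ωgh n) ((n : ℝ) ^ 8) N μ ν b
        (Sum.inr (Sum.inl (((0 : Fin 3), (0 : Fin 3), (0 : Fin 3), (0 : Fin 3))))) w) = fun _ => (0 : ℝ) := by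
    intro b; funext w; rw [restK'_bub]; simp
  simp_rw [h0, fullSum_zero', mul_zero, sum_const_zero, abs_zero, le_refl]

/-- [folklore] the re-cut ghost bubble `0000` word is `0`. -/
theorem hLoc_gbub_zero : ∀ n : ℕ, 2 ≤ n → ∀ [NeZero n],
    |∑ b ∈ (univ : Finset (Fin 4 → Fin n)).image resSite, ((n : ℝ) ^ 4)⁻¹ *
      fullSum (fun w : Pt => restK' n a (gfrz n a b) (cE n) (cΛ n) (cR n) (cK n) (cQ n) (cE₂ n) (cJ4 n) (cΛ₂ n) (cR₂ n) (cQ₂ n) (x₀ n)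
        (WE n) (WJ n) (WΛ n) (WR n) (WQ n) (ωgl n) (ωgh n) ((n : ℝ) ^ 8) N μ ν b
          (Sum.inr (Sum.inr (Sum.inr (Sum.inl (((0 : Fin 2), (0 : Fin 2), (0 : Fin 2), (0 : Fin 2))))))) w)| ≤ 0 := by
  intro n _ _
  have h0 : ∀ b : Pt, (fun w : Pt => restK' n a (gfrz n a b) (cE n) (cΛ n) (cR n) (cK n) (cQ n) (cE₂ n) (cJ4 n) (cΛ₂ n) (cR₂ n) (cQ₂ n) (x₀ n)
      (WE n) (WJ n) (WΛ n) (WR n) (WQ n) (ωgl n) (ωgh n) ((n : ℝ) ^ 8) N μ ν b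
        (Sum.inr (Sum.inr (Sum.inr (Sum.inl (((0 : Fin 2), (0 : Fin 2), (0 : Fin 2), (0 : Fin 2))))))) w) = fun _ => (0 : ℝ) := by
    intro b; funext w; rw [restK'_gbub]; simp
  simp_rw [h0, fullSum_zero', mul_zero, sum_const_zero, abs_zero, le_refl]

/-- [folklore] **L-BUB WITH THE ZERO WORD**: one constant per leg pair `(r,r′)` (leaf-03-g12's `hLoc_bub_of_prop12` for `(r,r′) ≠ (0,0)`, and `0` for the re-cut zero word). -/
theorem exists_hLoc_bub_all (ha : 0 < a) (h12 : B5.Prop12Printed (fam nOf hn1 MOf a ha)) (h126 : B5.Kernel126_127Printed (kfam nOf MOf))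
    (hlam : ∀ n : ℕ, 2 ≤ n → ωgl n * cE n ^ 2 = 2 * N ^ 2 * (n : ℝ) ^ 8) (r r' : Fin 3) :
    ∃ C : ℝ, ∀ n : ℕ, 2 ≤ n → ∀ [NeZero n],
      |∑ b ∈ (univ : Finset (Fin 4 → Fin n)).image resSite, ((n : ℝ) ^ 4)⁻¹ *
        fullSum (fun w : Pt => restK' n a (gfrz n a b) (cE n) (cΛ n) (cR n) (cK n) (cQ n) (cE₂ n) (cJ4 n) (cΛ₂ n) (cR₂ n) (cQ₂ n) (x₀ n)
          (WE n) (WJ n) (WΛ n) (WR n) (WQ n) (ωgl n) (ωgh n) ((n : ℝ) ^ 8) N μ ν b (Sum.inr (Sum.inl ((0 : Fin 3), (0 : Fin 3), r, r'))) w)| ≤ C := by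
  by_cases hrr : r = 0 ∧ r' = 0
  · obtain ⟨hr, hr'⟩ := hrr
    subst hr; subst hr'
    exact ⟨0, hLoc_bub_zero⟩
  · obtain ⟨C, _, hC⟩ := hLoc_bub_of_prop12 (cΛ := cΛ) (cR := cR) (cK := cK) (cQ := cQ) (cE₂ := cE₂) (cJ4 := cJ4) (cΛ₂ := cΛ₂) (cR₂ := cR₂) (cQ₂ := cQ₂)
      (x₀ := x₀) (ωgh := ωgh) (WE := WE) (WJ := WJ) (WΛ := WΛ) (WR := WR) (WQ := WQ) (μ := μ) (ν := ν) ha h12 h126 hlam r r' hrr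
    exact ⟨C, hC⟩

/-! ## §2 The LOCAL group hypothesis of the END -/

/-- [folklore] in `Fin 3`, not `1` and not `2` is `0`. -/
theorem fin3_eq_zero {i : Fin 3} (h1 : i ≠ 1) (h2 : i ≠ 2) : i = 0 := by
  fin_cases i <;> simp_all

/-- [folklore] in `Fin 2`, not `1` is `0`. -/
theorem fin2_eq_zero {i : Fin 2} (h1 : i ≠ 1) : i = 0 := by
  fin_cases i <;> simp_all

/-- [folklore] **«L-WIRE»: THE LOCAL GROUP HYPOTHESIS `hLoc` OF `RoadEndBFxRows.hGrp_of_rows` FROM THE PER-WORD THEOREMS**, modulo [B5, Prop. 1.2] ∧ [B5, (1.126)–(1.127)]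
BY NAME, the pins `hlam` (`ωgl·cE² = 2N²n⁸`) and `hJ` (`cJ4 = 0`, R-6), the END's slot-E sockets (`hδ₀`∕`hδE` rate floor, `hWE` bi-localisation, `hsuppE` finite support
radius `ρE`, `hkE` the scaling letter `|ωgl n·cE₂ n|·C_E n ≤ k_E·n⁸` — MET at the pins for an n-free table constant), and SIX displayed word bounds: the three slot-R
tadpoles `hTadR` («L-TAD-R»: the projector second-jet table `WR` awaits its (A2) pin) and the three local ghost bubbles `hGbub` («L-GBUB», claimable):
`∃ CL : RestIdx → ℝ, ∀ n ≥ 2, ∀ τ ∈ localFibre, |Σ_{b ∈ image resSite} n⁻⁴·fullSum (w ↦ restK′ n a (gfrz n a b) … μ ν b τ w)| ≤ CL τ` (a CONSTANT vector: the sum of the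
absolute values of the family constants). -/
theorem hLoc_of_prop12 (ha : 0 < a) (h12 : B5.Prop12Printed (fam nOf hn1 MOf a ha)) (h126 : B5.Kernel126_127Printed (kfam nOf MOf))
    (hlam : ∀ n : ℕ, 2 ≤ n → ωgl n * cE n ^ 2 = 2 * N ^ 2 * (n : ℝ) ^ 8) (hJ : ∀ n : ℕ, cJ4 n = 0)
    -- the END's slot-E sockets
    {ρE : ℕ} {CwE δE : ℕ → ℝ} {δ₀ kE : ℝ} (hδ₀ : 0 < δ₀) (hδE : ∀ n, δ₀ ≤ δE n)
    (hWE : ∀ n κ u l u', BiLoc (slotTab (WE n) (WJ n) (WΛ n) (WR n) (WQ n) 0 κ u l u') u u' (CwE n) (δE n))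
    (hsuppE : ∀ n κ u l u', ρE < supNorm (u - u') → slotTab (WE n) (WJ n) (WΛ n) (WR n) (WQ n) 0 κ u l u' = 0)
    (hkE : ∀ n : ℕ, 2 ≤ n → |ωgl n * slotWt (cE₂ n) (cJ4 n) (cΛ₂ n) (cR₂ n) (cQ₂ n) 0| * CwE n ≤ kE * (n : ℝ) ^ 8)
    -- «L-TAD-R»: the three slot-R tadpole words, displayed
    {CR : Fin 3 → ℝ}
    (hTadR : ∀ (r : Fin 3) (n : ℕ), 2 ≤ n → ∀ [NeZero n],
      |∑ b ∈ (univ : Finset (Fin 4 → Fin n)).image resSite, ((n : ℝ) ^ 4)⁻¹ *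
        fullSum (fun w : Pt => restK' n a (gfrz n a b) (cE n) (cΛ n) (cR n) (cK n) (cQ n) (cE₂ n) (cJ4 n) (cΛ₂ n) (cR₂ n) (cQ₂ n) (x₀ n)
          (WE n) (WJ n) (WΛ n) (WR n) (WQ n) (ωgl n) (ωgh n) ((n : ℝ) ^ 8) N μ ν b (Sum.inl ((3 : Fin 5), r)) w)| ≤ CR r)
    -- «L-GBUB»: the three local ghost bubble words, displayed
    {CG : Fin 2 → Fin 2 → ℝ}
    (hGbub : ∀ (r r' : Fin 2), ¬(r = 0 ∧ r' = 0) → ∀ n : ℕ, 2 ≤ n → ∀ [NeZero n],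
      |∑ b ∈ (univ : Finset (Fin 4 → Fin n)).image resSite, ((n : ℝ) ^ 4)⁻¹ *
        fullSum (fun w : Pt => restK' n a (gfrz n a b) (cE n) (cΛ n) (cR n) (cK n) (cQ n) (cE₂ n) (cJ4 n) (cΛ₂ n) (cR₂ n) (cQ₂ n) (x₀ n)
          (WE n) (WJ n) (WΛ n) (WR n) (WQ n) (ωgl n) (ωgh n) ((n : ℝ) ^ 8) N μ ν b
            (Sum.inr (Sum.inr (Sum.inr (Sum.inl ((0 : Fin 2), (0 : Fin 2), r, r'))))) w)| ≤ CG r r') :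
    ∃ CL : RestIdx → ℝ, ∀ n : ℕ, 2 ≤ n → ∀ [NeZero n], ∀ τ ∈ localFibre,
      |∑ b ∈ (univ : Finset (Fin 4 → Fin n)).image resSite, ((n : ℝ) ^ 4)⁻¹ *
        fullSum (fun w : Pt => restK' n a (gfrz n a b) (cE n) (cΛ n) (cR n) (cK n) (cQ n) (cE₂ n) (cJ4 n) (cΛ₂ n) (cR₂ n) (cQ₂ n) (x₀ n)
          (WE n) (WJ n) (WΛ n) (WR n) (WQ n) (ωgl n) (ωgh n) ((n : ℝ) ^ 8) N μ ν b τ w)| ≤ CL τ := by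
  classical
  -- the per-family constants
  obtain ⟨CX, _, hX⟩ := hLoc_crossE'_of_prop12 (cΛ := cΛ) (cR := cR) (cK := cK) (cQ := cQ) (cE₂ := cE₂) (cJ4 := cJ4) (cΛ₂ := cΛ₂) (cR₂ := cR₂) (cQ₂ := cQ₂)
    (x₀ := x₀) (ωgh := ωgh) (WE := WE) (WJ := WJ) (WΛ := WΛ) (WR := WR) (WQ := WQ) (μ := μ) (ν := ν) ha h12 h126 hlam
  have hB := fun r r' : Fin 3 => exists_hLoc_bub_all (cΛ := cΛ) (cR := cR) (cK := cK) (cQ := cQ) (cE₂ := cE₂) (cJ4 := cJ4) (cΛ₂ := cΛ₂) (cR₂ := cR₂)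
    (cQ₂ := cQ₂) (x₀ := x₀) (ωgh := ωgh) (WE := WE) (WJ := WJ) (WΛ := WΛ) (WR := WR) (WQ := WQ) (μ := μ) (ν := ν) ha h12 h126 hlam r r'
  choose CB hCB using hB
  -- the slot-E constant (the same for the three leg pieces)
  obtain ⟨KE, hKE⟩ : ∃ KE : ℝ, KE = kE * ((cG0 4 + (woodburyDc 0 + ellD0 4 a) + ellD0 4 a) + (cG0 4 + (woodburyDc 0 + ellD0 4 a) + ellD0 4 a)) *
    ((2 * (ρE : ℝ) + 1) ^ 4 * ((ρE : ℝ) ^ 2 * (8 * (Zl 4 δ₀) ^ 2))) := ⟨_, rfl⟩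
  have hE : ∀ (r : Fin 3) (n : ℕ), 2 ≤ n → ∀ [NeZero n],
      |∑ b ∈ (univ : Finset (Fin 4 → Fin n)).image resSite, ((n : ℝ) ^ 4)⁻¹ *
        fullSum (fun w : Pt => restK' n a (gfrz n a b) (cE n) (cΛ n) (cR n) (cK n) (cQ n) (cE₂ n) (cJ4 n) (cΛ₂ n) (cR₂ n) (cQ₂ n) (x₀ n)
          (WE n) (WJ n) (WΛ n) (WR n) (WQ n) (ωgl n) (ωgh n) ((n : ℝ) ^ 8) N μ ν b (Sum.inl ((0 : Fin 5), r)) w)| ≤ KE := by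
    intro r n hn _
    rw [hKE]
    exact hLoc_tad_of_local_entry_scaling (cE := cE) (cΛ := cΛ) (cR := cR) (cK := cK) (cQ := cQ) (x₀ := x₀) (ωgh := ωgh) (N := N) (μ := μ) (ν := ν)
      ((0 : Fin 5), r) ha hδ₀ hδE hWE hsuppE hkE n hn
  -- ONE constant for every local word: the sum of the absolute values
  obtain ⟨K, hK⟩ : ∃ K : ℝ, K = |KE| + |CX| + (∑ r : Fin 3, |CR r|) + (∑ r : Fin 3, ∑ r' : Fin 3, |CB r r'|) + (∑ r : Fin 2, ∑ r' : Fin 2, |CG r r'|) := ⟨_, rfl⟩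
  have hS3 : 0 ≤ ∑ r : Fin 3, |CR r| := sum_nonneg fun _ _ => abs_nonneg _
  have hS33 : 0 ≤ ∑ r : Fin 3, ∑ r' : Fin 3, |CB r r'| := sum_nonneg fun _ _ => sum_nonneg fun _ _ => abs_nonneg _
  have hS22 : 0 ≤ ∑ r : Fin 2, ∑ r' : Fin 2, |CG r r'| := sum_nonneg fun _ _ => sum_nonneg fun _ _ => abs_nonneg _
  have hKEle : KE ≤ K := by rw [hK]; have := le_abs_self KE; have := abs_nonneg CX; linarith
  have hCXle : CX ≤ K := by rw [hK]; have := le_abs_self CX; have := abs_nonneg KE; linarith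
  have h0le : 0 ≤ K := by rw [hK]; have := abs_nonneg KE; have := abs_nonneg CX; linarith
  have hCRle : ∀ r, CR r ≤ K := fun r => by
    rw [hK]
    have h1 : |CR r| ≤ ∑ r : Fin 3, |CR r| := single_le_sum (f := fun r => |CR r|) (fun _ _ => abs_nonneg _) (mem_univ r)
    have := le_abs_self (CR r); have := abs_nonneg KE; have := abs_nonneg CX; linarith
  have hCBle : ∀ r r', CB r r' ≤ K := fun r r' => by
    rw [hK]
    have h1 : |CB r r'| ≤ ∑ r' : Fin 3, |CB r r'| := single_le_sum (f := fun r' => |CB r r'|) (fun _ _ => abs_nonneg _) (mem_univ r')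
    have h2 : ∑ r' : Fin 3, |CB r r'| ≤ ∑ r : Fin 3, ∑ r' : Fin 3, |CB r r'| :=
      single_le_sum (f := fun r => ∑ r' : Fin 3, |CB r r'|) (fun _ _ => sum_nonneg fun _ _ => abs_nonneg _) (mem_univ r)
    have := le_abs_self (CB r r'); have := abs_nonneg KE; have := abs_nonneg CX; linarith
  have hCGle : ∀ r r', CG r r' ≤ K := fun r r' => by
    rw [hK]
    have h1 : |CG r r'| ≤ ∑ r' : Fin 2, |CG r r'| := single_le_sum (f := fun r' => |CG r r'|) (fun _ _ => abs_nonneg _) (mem_univ r')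
    have h2 : ∑ r' : Fin 2, |CG r r'| ≤ ∑ r : Fin 2, ∑ r' : Fin 2, |CG r r'| :=
      single_le_sum (f := fun r => ∑ r' : Fin 2, |CG r r'|) (fun _ _ => sum_nonneg fun _ _ => abs_nonneg _) (mem_univ r)
    have := le_abs_self (CG r r'); have := abs_nonneg KE; have := abs_nonneg CX; linarith
  refine ⟨fun _ => K, fun n hn _ τ hτ => ?_⟩
  rw [mem_localFibre] at hτ
  obtain ⟨hτ1, hτ2, hτ3⟩ := hτ
  rcases τ with ⟨s, r⟩ | ⟨i, j, r, r'⟩ | q | ⟨i, j, r, r'⟩ | k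
  · -- gluon tadpoles: `s ∈ {0, 1, 3}` (`s = 2` is a Λ-word, `s = 4` a needle word)
    have hs2 : s ≠ 2 := fun h => hτ1 ((mem_lamFibre_tad (s, r)).2 h)
    have hs4 : s ≠ 4 := fun h => hτ2 ((mem_needleFibre'_tad (s, r)).2 h)
    fin_cases s
    · exact (hE r n hn).trans hKEle
    · exact (hLoc_tad_J_of_cJ4_zero (a := a) (cE := cE) (cΛ := cΛ) (cR := cR) (cK := cK) (cQ := cQ) (cE₂ := cE₂) (cΛ₂ := cΛ₂) (cR₂ := cR₂) (cQ₂ := cQ₂)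
        (x₀ := x₀) (ωgl := ωgl) (ωgh := ωgh) (WE := WE) (WJ := WJ) (WΛ := WΛ) (WR := WR) (WQ := WQ) (N := N) (μ := μ) (ν := ν) r hJ n hn).trans h0le
    · exact absurd rfl hs2
    · exact (hTadR r n hn).trans (hCRle r)
    · exact absurd rfl hs4
  · -- gluon bubbles: `i = j = 0` (`i = 1 ∨ j = 1` is a Λ-word, `i = 2 ∨ j = 2` a needle word)
    have hl := (mem_lamFibre_bub (i, j, r, r')).not.1 hτ1
    have hm := (mem_needleFibre'_bub (i, j, r, r')).not.1 hτ2
    have hi1 : i ≠ 1 := fun h => hl (Or.inl h)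
    have hj1 : j ≠ 1 := fun h => hl (Or.inr h)
    have hi2 : i ≠ 2 := fun h => hm ⟨Or.inl h, hi1, hj1⟩
    have hj2 : j ≠ 2 := fun h => hm ⟨Or.inr h, hi1, hj1⟩
    obtain rfl := fin3_eq_zero hi1 hi2
    obtain rfl := fin3_eq_zero hj1 hj2
    exact (hCB r r' n hn).trans (hCBle r r')
  · -- ghost tadpoles are needle words
    exact absurd (mem_needleFibre'_gtad q) hτ2
  · -- ghost bubbles: `i = j = 0` (`i = 1 ∨ j = 1` is a needle word)
    have hm := (mem_needleFibre'_gbub (i, j, r, r')).not.1 hτ2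
    have hi1 : i ≠ 1 := fun h => hm (Or.inl h)
    have hj1 : j ≠ 1 := fun h => hm (Or.inr h)
    obtain rfl := fin2_eq_zero hi1
    obtain rfl := fin2_eq_zero hj1
    by_cases hrr : r = 0 ∧ r' = 0
    · obtain ⟨hr, hr'⟩ := hrr
      subst hr; subst hr'
      exact (hLoc_gbub_zero (a := a) (cE := cE) (cΛ := cΛ) (cR := cR) (cK := cK) (cQ := cQ) (cE₂ := cE₂) (cJ4 := cJ4) (cΛ₂ := cΛ₂) (cR₂ := cR₂)
        (cQ₂ := cQ₂) (x₀ := x₀) (ωgl := ωgl) (ωgh := ωgh) (WE := WE) (WJ := WJ) (WΛ := WΛ) (WR := WR) (WQ := WQ) (N := N) (μ := μ) (ν := ν) n hn).trans h0le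
    · exact (hGbub r r' hrr n hn).trans (hCGle r r')
  · -- the last summand: the corner (`k = 0`, excluded) and the cross word (`k = 1`)
    fin_cases k
    · exact absurd rfl hτ3
    · exact (hX n hn).trans hCXle

/-! ## §3 (v1.1, APPENDED 2026-08-21 after leaf-04-g10's «L-TAD-R GENERIC» `LocalTadpoleRowsDecay` p278165 landed) The LOCAL hypothesis with slot R's words as SOCKETS -/

open Summit.QuantumFields.BalabanUV.Beta.D1BFx.LocalTadpoleRowsDecay (hLoc_tad_of_decay_scaling) in
/-- [folklore] **«L-WIRE» v1.1: THE LOCAL GROUP HYPOTHESIS `hLoc` WITH THE THREE SLOT-R TADPOLES SUPPLIED BY leaf-04-g10's `hLoc_tad_of_decay_scaling`** — the displayed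
word bounds `hTadR` of `hLoc_of_prop12` replaced by slot R's SOCKETS: a decaying bi-localisation envelope of the slot-3 table (`hWR`: `CwR n·e^{−(θR∕n)‖u−u′‖}` at rate
`δR n ≥ δ₀R∕n`) and its units line `hkR : |ωgl n·slotWt … 3|·CwR n·n⁶ ≤ kR` (both = the (A2) readout of `WR`, the projector second jets; DISPLAYED, ruled nowhere here).
What stays displayed as WORD bounds: the three local ghost bubbles `hGbub` («L-GBUB»: under reading (i) of the END's `hω` NOT suppliable as an n-uniform bound —
owner ruling ρ-g11-4, Q-GU-1). -/
theorem hLoc_of_prop12' (ha : 0 < a) (h12 : B5.Prop12Printed (fam nOf hn1 MOf a ha)) (h126 : B5.Kernel126_127Printed (kfam nOf MOf))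
    (hlam : ∀ n : ℕ, 2 ≤ n → ωgl n * cE n ^ 2 = 2 * N ^ 2 * (n : ℝ) ^ 8) (hJ : ∀ n : ℕ, cJ4 n = 0)
    -- the END's slot-E sockets
    {ρE : ℕ} {CwE δE : ℕ → ℝ} {δ₀ kE : ℝ} (hδ₀ : 0 < δ₀) (hδE : ∀ n, δ₀ ≤ δE n)
    (hWE : ∀ n κ u l u', BiLoc (slotTab (WE n) (WJ n) (WΛ n) (WR n) (WQ n) 0 κ u l u') u u' (CwE n) (δE n))
    (hsuppE : ∀ n κ u l u', ρE < supNorm (u - u') → slotTab (WE n) (WJ n) (WΛ n) (WR n) (WQ n) 0 κ u l u' = 0)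
    (hkE : ∀ n : ℕ, 2 ≤ n → |ωgl n * slotWt (cE₂ n) (cJ4 n) (cΛ₂ n) (cR₂ n) (cQ₂ n) 0| * CwE n ≤ kE * (n : ℝ) ^ 8)
    -- slot R's sockets (the (A2) readout of `WR`)
    {CwR δR : ℕ → ℝ} {θR δ₀R kR : ℝ} (hθR : 0 < θR) (hδR : ∀ n, 0 < δR n) (hδ₀R : 0 < δ₀R) (hδRge : ∀ n : ℕ, δ₀R / n ≤ δR n) (hCwR : ∀ n, 0 ≤ CwR n)
    (hWR : ∀ n κ u l u', BiLoc (slotTab (WE n) (WJ n) (WΛ n) (WR n) (WQ n) 3 κ u l u') u u' (CwR n * Real.exp (-(θR / n) * supNorm (u - u'))) (δR n))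
    (hkR : ∀ n : ℕ, 2 ≤ n → |ωgl n * slotWt (cE₂ n) (cJ4 n) (cΛ₂ n) (cR₂ n) (cQ₂ n) 3| * CwR n * (n : ℝ) ^ 6 ≤ kR)
    -- «L-GBUB»: the three local ghost bubble words, displayed
    {CG : Fin 2 → Fin 2 → ℝ}
    (hGbub : ∀ (r r' : Fin 2), ¬(r = 0 ∧ r' = 0) → ∀ n : ℕ, 2 ≤ n → ∀ [NeZero n],
      |∑ b ∈ (univ : Finset (Fin 4 → Fin n)).image resSite, ((n : ℝ) ^ 4)⁻¹ *
        fullSum (fun w : Pt => restK' n a (gfrz n a b) (cE n) (cΛ n) (cR n) (cK n) (cQ n) (cE₂ n) (cJ4 n) (cΛ₂ n) (cR₂ n) (cQ₂ n) (x₀ n)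
          (WE n) (WJ n) (WΛ n) (WR n) (WQ n) (ωgl n) (ωgh n) ((n : ℝ) ^ 8) N μ ν b
            (Sum.inr (Sum.inr (Sum.inr (Sum.inl ((0 : Fin 2), (0 : Fin 2), r, r'))))) w)| ≤ CG r r') :
    ∃ CL : RestIdx → ℝ, ∀ n : ℕ, 2 ≤ n → ∀ [NeZero n], ∀ τ ∈ localFibre,
      |∑ b ∈ (univ : Finset (Fin 4 → Fin n)).image resSite, ((n : ℝ) ^ 4)⁻¹ *
        fullSum (fun w : Pt => restK' n a (gfrz n a b) (cE n) (cΛ n) (cR n) (cK n) (cQ n) (cE₂ n) (cJ4 n) (cΛ₂ n) (cR₂ n) (cQ₂ n) (x₀ n)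
          (WE n) (WJ n) (WΛ n) (WR n) (WQ n) (ωgl n) (ωgh n) ((n : ℝ) ^ 8) N μ ν b τ w)| ≤ CL τ :=
  hLoc_of_prop12 ha h12 h126 hlam hJ hδ₀ hδE hWE hsuppE hkE
    (fun r n hn _ => hLoc_tad_of_decay_scaling (cE := cE) (cΛ := cΛ) (cR := cR) (cK := cK) (cQ := cQ) (x₀ := x₀) (ωgh := ωgh) (N := N) (μ := μ) (ν := ν)
      ((3 : Fin 5), r) ha hθR hδR hδ₀R hδRge hCwR hWR hkR n hn) hGbub

end Summit.QuantumFields.BalabanUV.Beta.D1BFx.LocalGroupRow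

end
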